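import Summits.BirchSwinnertonDyer.BirchSwinnertonDyer.Theorems.GenusKolyvaginAtTwoGenusPrimitiveSupplyAtTwoTwistUnramifiedGoodNorm
import HarnessLib

/-!
# Route `GenusKolyvaginAtTwo`, crux #2 `GenusPrimitiveSupplyAtTwo` (stmt-BirchSwinnertonDyer-22136):
# `H¹(Gal(K'/K_v), E(K')) = 0` AT A PLACE OF GOOD REDUCTION UNRAMIFIED IN `K(√d)`, in the currency of the geometric points `E(K̄_v)`
# — the «anti-norm» companion of file 38's `hnorm` (every `Γ_v`-fixed point is a norm): every point fixed by `Gal(K̄_v/K_v(ι√d))`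
# and ANTI-fixed by the flip `τ₀` is `τ₀Q − Q`

Width seat `bsd-line-gk2-p5` g14 (cell `bsd-f1-sign2`, SUPPLY lineage of crux 22136), file 31 of the series; companion of files 37/38
(`…TwistNormDescent`, `…TwistUnramifiedGoodNorm`: Galois descent of Kramer–Tunnell's `[E(K')^σ : N E(K')] = 1` to the engine's `hnorm`).
THEOREMS ONLY (no definition, no named fact, no `sorry`, no local instance); helper `--supports stmt-BirchSwinnertonDyer-22136`; no item
is closed; BSD is not proved by any of this.

WHY. The PRIME-TWIST dictionary of the cell's DESC-§17-R (file 30 `…PrimeTwistDescAdmissible`: `TwistSelmerEqRelaxedAtInfinityAtTwo` BY NAME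
modulo ONE brick) needs, at a good prime `q` INERT in `ℚ(√d)`, the comparison `PrimeTwist.selmerLocalKer W χ ℚ_q = W.selmerLocalKer ℚ_q 2`.
In cocycle currency (file 32) the inclusion `H¹_f ≤ H¹_𝒜` consumes Mazur's NORM theorem (file 38's `hnorm`) and the inclusion `H¹_𝒜 ≤ H¹_f`
consumes the vanishing `H¹(Gal(K'/K_v), E(K')) = 0` for the unramified quadratic `K' = K_v(ι√d)` — Kramer–Tunnell 1982, proof of Lemma 6.1
(«`|H¹(G, E₀(K))| = 1`»), in the tree as `KramerTunnell1982.exists_map_sub_eq_of_isUnit_Δ` for a unit-discriminant `𝒪_v`-model. This file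
transports it to the series' currency, exactly as files 37/38 transported the norm index:

* §128 `exists_map_sub_eq_of_hasGoodReductionAt` — for `W/K` good at `v`, `K' ≤ K_v^{nr}` quadratic with `σ ≠ 1`: every `T ∈ (W ⊗ K_v)(K')` with
  `T + σT = 0` is `σQ − Q` (unit-discriminant model of file 38 §89 + the variable-change transport `VariableChange.pointEquivBaseChange`).
* §129 `exists_map_val_eq_of_forall_smul_eq` (Galois descent to `K'`-points: a geometric point fixed by every `g ∈ Γ_F` that is the identity on
  `K'` comes from `V(K')`, via Mathlib's `InfiniteGalois.fixedField_fixingSubgroup`) and `exists_fixed_sub_eq_of_forall_exists_map_sub_eq`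
  (`H¹ = 0` on `K'`-points ⟹ every such point `T` with `T + τ₀T = 0` is `τ₀Q − Q` with `Q` fixed by the same subgroup, `τ₀|_{K'} = σ`).
* §130 **`forall_exists_sub_of_hasGoodReductionAt_of_mem_maxUnramified`** — the series' currency (`localPoints W K_v`, `α = ι√d ∈ K_v^{nr}`,
  `d ∉ K_v²`, `τ₀` flipping `α`): every `T ∈ W(K̄_v)` fixed by the stabiliser of `α` with `T + τ₀T = 0` is `τ₀Q − Q` with `Q` fixed by the
  stabiliser of `α` — the `hanti` input of file 32.

Honest framing: KNOWN (Kramer–Tunnell 1982 Lemma 6.1 / Mazur 1972; Galois descent); kernel-new plumbing; beyond-print theorem: no.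
Crux 22136 stays OPEN at (U) 24947 ∧ (CONV₂) 19220/24948. BSD is not proved by any of this.

References: [KramerTunnell1982] §6 proof of Lemma 6.1 (p. 327); [Mazur1972] Cor. 4.4; [MazurRubin2010] Lemma 2.9, Lemma 2.10 (v);
[SilvermanAEC2009] VIII.§1 (Galois descent for points), III.3.1 (b).
-/

set_option linter.dupNamespace false -- tree convention: `Summit.BirchSwinnertonDyer.BirchSwinnertonDyer.Theorems` (summit = sub-problem)
set_option autoImplicit false

noncomputable section

open scoped Classical ValuativeRel

namespace Summit.BirchSwinnertonDyer.BirchSwinnertonDyer.Theorems.GenusKolyArch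

open WeierstrassCurve Field NumberField IsDedekindDomain Function
open Literature.NumberTheory.EllipticCurves Literature.NumberTheory.GaloisRepresentations
open Literature.NumberTheory.GaloisRepresentations.IsNonarchimedeanLocalField (maxUnramified)
open Literature.NumberTheory.EllipticCurves.KramerTunnell1982 (exists_map_sub_eq_of_isUnit_Δ)

universe u

/-! ## §128 `H¹(Gal(K'/K_v), (W ⊗ K_v)(K')) = 0` for good reduction and `K'/K_v` unramified quadratic -/

section GoodH1

variable {K : Type} [Field K] [NumberField K] (W : WeierstrassCurve K) (v : HeightOneSpectrum (𝓞 K))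

/-- **Kramer–Tunnell's `|H¹(G, E(K'))| = 1` at a place of GOOD reduction, in the point currency of `W ⊗ K_v`:** for the unramified quadratic
`K' ⊆ K̄_v` (`K' ≤ maxUnramified`, `[K' : K_v] = 2`, `σ ≠ 1`), every `K'`-point `T` of `W` with `T + σT = O` is `σQ − Q` — the unit-discriminant
model of `exists_integer_model_of_hasGoodReductionAt` (file 38 §89) satisfies it (`KramerTunnell1982.exists_map_sub_eq_of_isUnit_Δ`), and the
statement is transported to `W ⊗ K_v` along the `σ`-equivariant substitution `VariableChange.pointEquivBaseChange` (Silverman III.3.1 (b)).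
[cite: KramerTunnell1982, §6 proof of Lemma 6.1 (p. 327), |H¹(G, E₀(K))| = 1] [cite: SilvermanAEC2009, III.3.1(b)] -/
theorem exists_map_sub_eq_of_hasGoodReductionAt (hv : W.HasGoodReductionAt v)
    {K' : IntermediateField (v.adicCompletion K) (AlgebraicClosure (v.adicCompletion K))}
    (hK' : K' ≤ maxUnramified (v.adicCompletion K)) (h2 : Module.finrank (v.adicCompletion K) K' = 2)
    {σ : K' ≃ₐ[v.adicCompletion K] K'} (hσ : σ ≠ 1)
    {T : ((W.baseChange (v.adicCompletion K)).baseChange K').toAffine.Point}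
    (hT : T + Affine.Point.map (W' := W.baseChange (v.adicCompletion K)) (σ : K' →ₐ[v.adicCompletion K] K') T = 0) :
    ∃ Q : ((W.baseChange (v.adicCompletion K)).baseChange K').toAffine.Point,
      Affine.Point.map (W' := W.baseChange (v.adicCompletion K)) (σ : K' →ₐ[v.adicCompletion K] K') Q - Q = T := by
  obtain ⟨M, C, hΔ, hM⟩ := exists_integer_model_of_hasGoodReductionAt W v hv
  -- `H¹ = 0` for the unit-discriminant model `M ⊗ K_v = C • (W ⊗ K_v)`
  have hH : ∀ T' : ((C • W.baseChange (v.adicCompletion K)).baseChange K').toAffine.Point,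
      T' + Affine.Point.map (W' := C • W.baseChange (v.adicCompletion K)) (σ : K' →ₐ[v.adicCompletion K] K') T' = 0 →
      ∃ Q' : ((C • W.baseChange (v.adicCompletion K)).baseChange K').toAffine.Point,
        Affine.Point.map (W' := C • W.baseChange (v.adicCompletion K)) (σ : K' →ₐ[v.adicCompletion K] K') Q' - Q' = T' := by
    rw [← hM]
    intro T' hT'
    exact exists_map_sub_eq_of_isUnit_Δ M hΔ hK' h2 hσ hT'
  -- transport along the `σ`-equivariant substitution `e : (W ⊗ K_v)(K') ≃+ (C • (W ⊗ K_v))(K')`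
  set e := VariableChange.pointEquivBaseChange (W.baseChange (v.adicCompletion K)) C K' with he
  have heσ : ∀ P : ((W.baseChange (v.adicCompletion K)).baseChange K').toAffine.Point,
      e (Affine.Point.map (W' := W.baseChange (v.adicCompletion K)) (σ : K' →ₐ[v.adicCompletion K] K') P) =
        Affine.Point.map (W' := C • W.baseChange (v.adicCompletion K)) (σ : K' →ₐ[v.adicCompletion K] K') (e P) :=
    fun P ↦ VariableChange.pointEquivBaseChange_map_algEquiv (W.baseChange (v.adicCompletion K)) C σ P
  have hT' : e T + Affine.Point.map (W' := C • W.baseChange (v.adicCompletion K)) (σ : K' →ₐ[v.adicCompletion K] K') (e T) = 0 := by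
    rw [← heσ, ← map_add, hT, map_zero]
  obtain ⟨Q', hQ'⟩ := hH (e T) hT'
  refine ⟨e.symm Q', e.injective ?_⟩
  rw [map_sub, heσ, AddEquiv.apply_symm_apply, hQ']

end GoodH1

/-! ## §129 Galois descent to `K'`-points and the geometric form of `H¹ = 0` -/

section Descent

variable {F : Type u} [Field F] (V : WeierstrassCurve F) (K' : IntermediateField F (AlgebraicClosure F))

/-- **Galois descent to `K'`-points.** `F` perfect, `K' ⊆ F̄` an intermediate field: a geometric point of `V` fixed by every `g ∈ Γ_F` that is the
identity on `K'` is the image of a `K'`-rational point — its coordinates lie in the fixed field of `Gal(F̄/K')`, which is `K'`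
(Mathlib `InfiniteGalois.fixedField_fixingSubgroup`). [cite: SilvermanAEC2009, VIII.§1 (Galois descent for points)] -/
theorem exists_map_val_eq_of_forall_smul_eq [PerfectField F] {T : geomPoints V}
    (hT : ∀ g : absoluteGaloisGroup F,
      (∀ x : K', (show AlgebraicClosure F ≃ₐ[F] AlgebraicClosure F from g) (x : AlgebraicClosure F) = x) → g • T = T) :
    ∃ T₁ : (V.baseChange K').toAffine.Point, Affine.Point.map (W' := V) (IntermediateField.val K') T₁ = T := by
  haveI : IsGalois F (AlgebraicClosure F) := {}
  -- a coordinate fixed by `Gal(F̄/K')` lies in `K'`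
  have hdesc : ∀ z : AlgebraicClosure F,
      (∀ g : absoluteGaloisGroup F, (∀ x : K', (show AlgebraicClosure F ≃ₐ[F] AlgebraicClosure F from g) (x : AlgebraicClosure F) = x) →
        (show AlgebraicClosure F ≃ₐ[F] AlgebraicClosure F from g) z = z) → z ∈ K' := by
    intro z hz
    rw [← InfiniteGalois.fixedField_fixingSubgroup K', IntermediateField.mem_fixedField_iff]
    intro g hg
    rw [IntermediateField.mem_fixingSubgroup_iff] at hg
    exact hz g fun x ↦ hg x x.2
  change (V.baseChange (AlgebraicClosure F)).toAffine.Point at T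
  rcases T with _ | ⟨x, y, h⟩
  · exact ⟨0, rfl⟩
  · have hxy : ∀ g : absoluteGaloisGroup F,
        (∀ x : K', (show AlgebraicClosure F ≃ₐ[F] AlgebraicClosure F from g) (x : AlgebraicClosure F) = x) →
        (show AlgebraicClosure F ≃ₐ[F] AlgebraicClosure F from g) x = x ∧
          (show AlgebraicClosure F ≃ₐ[F] AlgebraicClosure F from g) y = y := by
      intro g hg
      have := hT g hg
      change Affine.Point.map ((show AlgebraicClosure F ≃ₐ[F] AlgebraicClosure F from g) :
          AlgebraicClosure F →ₐ[F] AlgebraicClosure F) (Affine.Point.some x y h) = Affine.Point.some x y h at this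
      rw [Affine.Point.map_some] at this
      simpa only [Affine.Point.some.injEq, AlgEquiv.coe_toAlgHom] using this
    have hx : x ∈ K' := hdesc x fun g hg ↦ (hxy g hg).1
    have hy : y ∈ K' := hdesc y fun g hg ↦ (hxy g hg).2
    have h₁ : (V.baseChange K').toAffine.Nonsingular ⟨x, hx⟩ ⟨y, hy⟩ :=
      (Affine.baseChange_nonsingular V (f := IntermediateField.val K') Subtype.val_injective ⟨x, hx⟩ ⟨y, hy⟩).mp h
    exact ⟨Affine.Point.some ⟨x, hx⟩ ⟨y, hy⟩ h₁, rfl⟩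

/-- **From `H¹ = 0` on `K'`-points to the geometric «anti-norm» statement.** `F` perfect, `K' ⊆ F̄` with an `F`-automorphism `σ`, `τ₀ ∈ Γ_F`
restricting to `σ` on `K'`. If every `T₁ ∈ V(K')` with `T₁ + σT₁ = O` is `σQ₁ − Q₁` (`H¹(⟨σ⟩, V(K')) = 0`), then every geometric point `T` fixed by
`Gal(F̄/K')` with `T + τ₀T = O` is `τ₀Q − Q` with `Q` fixed by `Gal(F̄/K')`: descend `T` to `T₁ ∈ V(K')` (§129), write `T₁ = σQ₁ − Q₁`, push `Q₁`
to `F̄`. [cite: KramerTunnell1982, §6 proof of Lemma 6.1 (p. 327)] [cite: SilvermanAEC2009, VIII.§1] -/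
theorem exists_fixed_sub_eq_of_forall_exists_map_sub_eq [PerfectField F] (σ : K' ≃ₐ[F] K')
    (hH : ∀ T₁ : (V.baseChange K').toAffine.Point,
      T₁ + Affine.Point.map (W' := V) (σ : K' →ₐ[F] K') T₁ = 0 →
        ∃ Q₁ : (V.baseChange K').toAffine.Point, Affine.Point.map (W' := V) (σ : K' →ₐ[F] K') Q₁ - Q₁ = T₁)
    {τ₀ : absoluteGaloisGroup F}
    (hτ₀ : ∀ x : K', (show AlgebraicClosure F ≃ₐ[F] AlgebraicClosure F from τ₀) (x : AlgebraicClosure F) =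
      ((σ x : K') : AlgebraicClosure F))
    {T : geomPoints V}
    (hTfix : ∀ g : absoluteGaloisGroup F,
      (∀ x : K', (show AlgebraicClosure F ≃ₐ[F] AlgebraicClosure F from g) (x : AlgebraicClosure F) = x) → g • T = T)
    (hT : T + τ₀ • T = 0) :
    ∃ Q : geomPoints V,
      (∀ g : absoluteGaloisGroup F,
        (∀ x : K', (show AlgebraicClosure F ≃ₐ[F] AlgebraicClosure F from g) (x : AlgebraicClosure F) = x) → g • Q = Q) ∧
      τ₀ • Q - Q = T := by
  obtain ⟨T₁, rfl⟩ := exists_map_val_eq_of_forall_smul_eq V K' hTfix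
  -- `T₁ + σT₁ = 0` (the inclusion of `K'`-points is injective and `τ₀` acts through `σ`)
  have hι : Function.Injective (Affine.Point.map (W' := V) (IntermediateField.val K')) := Affine.Point.map_injective _
  have hT₁ : T₁ + Affine.Point.map (W' := V) (σ : K' →ₐ[F] K') T₁ = 0 := by
    apply hι
    rw [map_add, map_zero, ← smul_map_val_eq_of_forall_apply V K' τ₀ σ hτ₀ T₁]
    exact hT
  obtain ⟨Q₁, hQ₁⟩ := hH T₁ hT₁
  refine ⟨(Affine.Point.map (W' := V) (IntermediateField.val K') Q₁ : geomPoints V),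
    fun g hg ↦ smul_map_val_eq_self_of_forall_apply V K' g hg Q₁, ?_⟩
  change Affine.Point.map (W' := V)
        ((show AlgebraicClosure F ≃ₐ[F] AlgebraicClosure F from τ₀) : AlgebraicClosure F →ₐ[F] AlgebraicClosure F)
        (Affine.Point.map (W' := V) (IntermediateField.val K') Q₁) -
      Affine.Point.map (W' := V) (IntermediateField.val K') Q₁ = Affine.Point.map (W' := V) (IntermediateField.val K') T₁
  rw [smul_map_val_eq_of_forall_apply V K' τ₀ σ hτ₀ Q₁, ← map_sub, hQ₁]

end Descent

/-! ## §130 The series' currency: `localPoints W K_v`, `α = ι√d`, the stabiliser of `α`, the flip `τ₀` -/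

section Local

variable {K : Type} [Field K] [NumberField K] (W : WeierstrassCurve K) (v : HeightOneSpectrum (𝓞 K)) {d : K}

/-- **THE `hanti` INPUT AT A PLACE OF GOOD REDUCTION UNRAMIFIED IN `K(√d)`**: `W` good at `v`, `ι√d ∈ K_v^{nr}`, `d ∉ K_v²`, `τ₀ ∈ Γ_{K_v}`
flipping `ι√d` ⟹ every point `T ∈ W(K̄_v)` fixed by the stabiliser of `ι√d` (the index-`2` subgroup `Gal(K̄_v/K_v(ι√d))`) with `T + τ₀T = O`
is `τ₀Q − Q` with `Q` fixed by that stabiliser (`H¹(Gal(K'/K_v), E(K')) = 0`, Kramer–Tunnell's proof of Lemma 6.1: §128 through §129 on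
`V = W ⊗ K_v`, `K' = K_v(ι√d)`, transported along the `Γ_{K_v}`-equivariant `baseChangeGeomPointsEquiv`). Companion of file 38's
`forall_exists_norm_of_hasGoodReductionAt_of_mem_maxUnramified`. [cite: KramerTunnell1982, §6 proof of Lemma 6.1 (p. 327)]
[cite: MazurRubin2010, proof of Lemma 2.10 (v)] -/
theorem forall_exists_sub_of_hasGoodReductionAt_of_mem_maxUnramified (hv : W.HasGoodReductionAt v)
    (hα : closureEmb (K := K) (v.adicCompletion K) (geomSqrt d) ∈ maxUnramified (v.adicCompletion K))
    (hd : ∀ s : v.adicCompletion K, s ^ 2 ≠ algebraMap K (v.adicCompletion K) d)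
    {τ₀ : absoluteGaloisGroup (v.adicCompletion K)}
    (hτ₀ : (show AlgebraicClosure (v.adicCompletion K) ≃ₐ[v.adicCompletion K] AlgebraicClosure (v.adicCompletion K) from τ₀)
        (closureEmb (K := K) (v.adicCompletion K) (geomSqrt d)) = -closureEmb (K := K) (v.adicCompletion K) (geomSqrt d)) :
    ∀ T : localPoints W (v.adicCompletion K),
      (∀ g : absoluteGaloisGroup (v.adicCompletion K),
        (show AlgebraicClosure (v.adicCompletion K) ≃ₐ[v.adicCompletion K] AlgebraicClosure (v.adicCompletion K) from g)
            (closureEmb (K := K) (v.adicCompletion K) (geomSqrt d)) = closureEmb (K := K) (v.adicCompletion K) (geomSqrt d) →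
          g • T = T) →
      T + τ₀ • T = 0 →
      ∃ Q : localPoints W (v.adicCompletion K),
        (∀ g : absoluteGaloisGroup (v.adicCompletion K),
          (show AlgebraicClosure (v.adicCompletion K) ≃ₐ[v.adicCompletion K] AlgebraicClosure (v.adicCompletion K) from g)
              (closureEmb (K := K) (v.adicCompletion K) (geomSqrt d)) = closureEmb (K := K) (v.adicCompletion K) (geomSqrt d) →
            g • Q = Q) ∧ τ₀ • Q - Q = T := by
  intro T hTfix hT
  haveI : CharZero (v.adicCompletion K) := charZero_of_injective_algebraMap (algebraMap K _).injective
  have h2 := finrank_adjoin_closureEmb_geomSqrt_eq_two v hd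
  haveI : Algebra.IsQuadraticExtension (v.adicCompletion K)
      (IntermediateField.adjoin (v.adicCompletion K) {closureEmb (K := K) (v.adicCompletion K) (geomSqrt d)}) :=
    { finrank_eq_two' := h2 }
  -- `σ := τ₀|_{K'}`, `σ(ι√d) = −ι√d`, `σ ≠ 1`
  set σ := (show AlgebraicClosure (v.adicCompletion K) ≃ₐ[v.adicCompletion K] AlgebraicClosure (v.adicCompletion K)
    from τ₀).restrictNormal
      (IntermediateField.adjoin (v.adicCompletion K) {closureEmb (K := K) (v.adicCompletion K) (geomSqrt d)}) with hσdef
  have hσ : ((σ (IntermediateField.AdjoinSimple.gen (v.adicCompletion K)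
      (closureEmb (K := K) (v.adicCompletion K) (geomSqrt d))) :
        IntermediateField.adjoin (v.adicCompletion K) {closureEmb (K := K) (v.adicCompletion K) (geomSqrt d)}) :
          AlgebraicClosure (v.adicCompletion K)) = -closureEmb (K := K) (v.adicCompletion K) (geomSqrt d) := by
    have h := AlgEquiv.restrictNormal_commutes
      (show AlgebraicClosure (v.adicCompletion K) ≃ₐ[v.adicCompletion K] AlgebraicClosure (v.adicCompletion K) from τ₀)
      (IntermediateField.adjoin (v.adicCompletion K) {closureEmb (K := K) (v.adicCompletion K) (geomSqrt d)})
      (IntermediateField.AdjoinSimple.gen (v.adicCompletion K) (closureEmb (K := K) (v.adicCompletion K) (geomSqrt d)))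
    rw [← hσdef] at h
    change ((σ _ : IntermediateField.adjoin (v.adicCompletion K) {closureEmb (K := K) (v.adicCompletion K) (geomSqrt d)}) :
      AlgebraicClosure (v.adicCompletion K)) = (show AlgebraicClosure (v.adicCompletion K) ≃ₐ[v.adicCompletion K]
        AlgebraicClosure (v.adicCompletion K) from τ₀) (closureEmb (K := K) (v.adicCompletion K) (geomSqrt d)) at h
    rw [h, hτ₀]
  have hα0 : closureEmb (K := K) (v.adicCompletion K) (geomSqrt d) ≠ 0 := by
    intro h0
    apply hd 0
    have h := closureEmb_geomSqrt_sq_eq_algebraMap (K := K) (d := d) v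
    rw [h0, zero_pow two_ne_zero, eq_comm, map_eq_zero] at h
    rw [h, zero_pow two_ne_zero]
  have hσ1 : σ ≠ 1 := by
    intro h1
    rw [h1, AlgEquiv.one_apply, IntermediateField.AdjoinSimple.coe_gen, eq_neg_iff_add_eq_zero, ← two_mul,
      mul_eq_zero] at hσ
    exact hσ.elim (fun h ↦ two_ne_zero h) hα0
  -- `H¹ = 0` on `K'`-points of `W ⊗ K_v` (§128), in geometric form (§129), transported to `localPoints`
  have hH := fun (T₁ : ((W.baseChange (v.adicCompletion K)).baseChange
      (IntermediateField.adjoin (v.adicCompletion K) {closureEmb (K := K) (v.adicCompletion K) (geomSqrt d)})).toAffine.Point) hT₁ ↦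
    exists_map_sub_eq_of_hasGoodReductionAt W v hv (adjoin_closureEmb_geomSqrt_le_maxUnramified v hα) h2 hσ1 (T := T₁) hT₁
  have hτ₀' := forall_apply_eq_of_apply_adjoin_gen_eq_apply (d := d) (v.adicCompletion K) τ₀ σ (hτ₀.trans hσ.symm)
  set e := W.baseChangeGeomPointsEquiv (v.adicCompletion K) with he
  have hTfix' : ∀ g : absoluteGaloisGroup (v.adicCompletion K),
      (∀ x : (IntermediateField.adjoin (v.adicCompletion K) {closureEmb (K := K) (v.adicCompletion K) (geomSqrt d)}),
        (show AlgebraicClosure (v.adicCompletion K) ≃ₐ[v.adicCompletion K] AlgebraicClosure (v.adicCompletion K) from g)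
          (x : AlgebraicClosure (v.adicCompletion K)) = x) → g • e.symm T = e.symm T := by
    intro g hg
    rw [← W.baseChangeGeomPointsEquiv_symm_smul (v.adicCompletion K) g T, hTfix g ?_]
    have := hg (IntermediateField.AdjoinSimple.gen (v.adicCompletion K) (closureEmb (K := K) (v.adicCompletion K) (geomSqrt d)))
    rwa [IntermediateField.AdjoinSimple.coe_gen] at this
  have hT' : e.symm T + τ₀ • e.symm T = 0 := by
    rw [← W.baseChangeGeomPointsEquiv_symm_smul (v.adicCompletion K) τ₀ T, ← map_add, hT, map_zero]
  obtain ⟨Q', hQ'fix, hQ'⟩ := exists_fixed_sub_eq_of_forall_exists_map_sub_eq (W.baseChange (v.adicCompletion K))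
    (IntermediateField.adjoin (v.adicCompletion K) {closureEmb (K := K) (v.adicCompletion K) (geomSqrt d)}) σ hH hτ₀' hTfix' hT'
  refine ⟨e Q', fun g hg ↦ ?_, ?_⟩
  · rw [← W.baseChangeGeomPointsEquiv_smul (v.adicCompletion K) g Q',
      hQ'fix g (forall_apply_eq_of_apply_adjoin_gen_eq (d := d) (v.adicCompletion K) g hg)]
  · rw [← W.baseChangeGeomPointsEquiv_smul (v.adicCompletion K) τ₀ Q', ← map_sub, hQ', he, AddEquiv.apply_symm_apply]

end Local

end Summit.BirchSwinnertonDyer.BirchSwinnertonDyer.Theorems.GenusKolyArch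

end
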